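import Mathlib
import Literature.Computability.Complexity.RangeAvoidance
import Literature.Computability.Complexity.SignDegreeXor
import Summits.PneNP.PneNP.Theorems.PstarPairwise
import Summits.PneNP.PneNP.Theorems.PairwiseSALevel

/-!
# The pairwise-independent fibre laws of `IP₃ = u₀u₁ ⊕ u₂u₃ ⊕ u₄u₅` (cell `pnp-ideate`, ROUND-22 item T22.1a(i))

FRONTIER range-avoidance ladder, rung F-N3 context (restricted-model lower bounds for the Sherali–Adams hierarchy; nothing here
bears on `P` vs `NP`).  The ROUND-22 hub `PairwiseSALevel.PairwiseLaws I y p μ` asks, for every output `j`, a probability law on its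
slot patterns supported on the fibre `{u | table j u = y j}`, with prescribed slot biases and PAIRWISE INDEPENDENT slots.  For the
6-local predicate `ipPred 3` (the quotient predicate `P₃` of the cycle-space reduction, memo §8b/§12) such laws exist with all biases
`r = √2/2`:

* `ip3Law r b` = the `r`-biased product law on `{0,1}⁶` conditioned on `IP₃(u) = b`, i.e. `2·∏ᵢ ρ_r(uᵢ)·[IP₃ u = b]`
  (the three AND-bits `uᵢu_{i+1}` are i.i.d. fair when `2r² = 1`, so the conditioning event has mass exactly `½`);
* `ip3Law_total`, `marg1_ip3Law` (every slot has bias `r`), `marg2_ip3Law` (every pair of slots is independent) — finite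
  identities in `r` modulo `2r² = 1`, each closed by an explicit `linear_combination`;
* `pairwiseLaws_ip3` : `PairwiseLaws I y (fun _ => √2/2) (fun j => ip3Law (√2/2) (y j))` for every pure `IP₃` instance and
  EVERY target `y`.
-/

set_option linter.dupNamespace false

open Finset Literature.Computability.Complexity
open Summit.PneNP.PneNP.Theorems.PstarPairwise (rho)
open Summit.PneNP.PneNP.Theorems.PairwiseSALevel (marg1 marg2 PairwiseLaws)

namespace Summit.PneNP.PneNP.Theorems.PstarIP3Law

variable {n m : ℕ}

/-! ## Sums over `{0,1}⁶` -/

/-- `{0,1}⁶` as iterated Booleans. -/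
def tup6Equiv : Bool × Bool × Bool × Bool × Bool × Bool ≃ (Fin 6 → Bool) where
  toFun p := ![p.1, p.2.1, p.2.2.1, p.2.2.2.1, p.2.2.2.2.1, p.2.2.2.2.2]
  invFun u := (u 0, u 1, u 2, u 3, u 4, u 5)
  left_inv p := rfl
  right_inv u := by
    funext i
    fin_cases i <;> rfl

/-- A sum over `{0,1}⁶` is a sixfold Boolean sum. -/
theorem sum_fin6 (g : (Fin 6 → Bool) → ℝ) :
    ∑ u, g u = ∑ a, ∑ b, ∑ c, ∑ d, ∑ e, ∑ f, g ![a, b, c, d, e, f] := by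
  rw [← Fintype.sum_equiv tup6Equiv (fun p => g (tup6Equiv p)) g (fun _ => rfl)]
  simp only [Fintype.sum_prod_type]
  rfl

/-- `IP₃` on an explicit pattern. -/
theorem ipPred_three_cons (a0 a1 a2 a3 a4 a5 : Bool) :
    ipPred 3 ![a0, a1, a2, a3, a4, a5] = xor (xor (a0 && a1) (a2 && a3)) (a4 && a5) := by
  cases a0 <;> cases a1 <;> cases a2 <;> cases a3 <;> cases a4 <;> cases a5 <;> rfl

/-! ## The law -/

/-- **The `IP₃` fibre law**: the `r`-biased product law conditioned on `IP₃(u) = b` (normalising factor `2`). -/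
noncomputable def ip3Law (r : ℝ) (b : Bool) (u : Fin 6 → Bool) : ℝ :=
  if ipPred 3 u = b then 2 * (rho r (u 0) * rho r (u 1) * rho r (u 2) * rho r (u 3) * rho r (u 4) * rho r (u 5)) else 0

/-- The law on an explicit pattern. -/
theorem ip3Law_cons (r : ℝ) (b a0 a1 a2 a3 a4 a5 : Bool) :
    ip3Law r b ![a0, a1, a2, a3, a4, a5] =
      if xor (xor (a0 && a1) (a2 && a3)) (a4 && a5) = b then
        2 * (rho r a0 * rho r a1 * rho r a2 * rho r a3 * rho r a4 * rho r a5) else 0 := by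
  rw [ip3Law, ipPred_three_cons]; rfl

/-- The law is supported on the fibre `IP₃ = b`. -/
theorem ip3Law_support (r : ℝ) (b : Bool) (u : Fin 6 → Bool) (h : ip3Law r b u ≠ 0) : ipPred 3 u = b := by
  by_contra hne
  exact h (if_neg hne)

/-- The law is non-negative for `0 ≤ r ≤ 1`. -/
theorem ip3Law_nonneg {r : ℝ} (h0 : 0 ≤ r) (h1 : r ≤ 1) (b : Bool) (u : Fin 6 → Bool) : 0 ≤ ip3Law r b u := by
  have hρ : ∀ a, 0 ≤ rho r a := fun a => by cases a <;> simp [rho] <;> linarith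
  unfold ip3Law
  split_ifs
  · have := hρ (u 0); have := hρ (u 1); have := hρ (u 2); have := hρ (u 3); have := hρ (u 4); have := hρ (u 5)
    positivity
  · exact le_rfl

/-- **Total mass `1`** (uses `2r² = 1`: the three AND-bits are fair, so `P(IP₃ = b) = ½`). -/
theorem ip3Law_total {r : ℝ} (hr : 2 * r ^ 2 = 1) (b : Bool) : ∑ u, ip3Law r b u = 1 := by
  cases b <;> simp [sum_fin6, ip3Law_cons, rho]
  · linear_combination ((-4)*r^4 + 4*r^2 - 1) * hr
  · linear_combination (4*r^4 - 4*r^2 + 1) * hr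

/-! ## Slot marginals: every slot has bias `r` -/

/-- **One-slot marginals**: `marg1 (ip3Law r b) s α = ρ_r(α)` for every slot `s` (uses `2r² = 1`). -/
theorem marg1_ip3Law {r : ℝ} (hr : 2 * r ^ 2 = 1) (b : Bool) (s : Fin 6) (α : Bool) : marg1 (ip3Law r b) s α = rho r α := by
  cases b <;> cases α
  · fin_cases s <;> simp [marg1, sum_fin6, ip3Law_cons, rho] <;> linear_combination ((-2)*r^3 + 2*r^2 + r - 1) * hr
  · fin_cases s <;> simp [marg1, sum_fin6, ip3Law_cons, rho] <;> linear_combination ((-4)*r^4 + 2*r^3 + 2*r^2 - r) * hr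
  · fin_cases s <;> simp [marg1, sum_fin6, ip3Law_cons, rho] <;> linear_combination (2*r^3 - 2*r^2 - r + 1) * hr
  · fin_cases s <;> simp [marg1, sum_fin6, ip3Law_cons, rho] <;> linear_combination (4*r^4 - 2*r^3 - 2*r^2 + r) * hr

/-! ## Pair marginals: every pair of slots is independent -/
/-- Symmetry of the two-slot marginal. -/
theorem marg2_comm (w : (Fin 6 → Bool) → ℝ) (i j : Fin 6) (α β : Bool) : marg2 w i j α β = marg2 w j i β α := by
  unfold PairwiseSALevel.marg2
  refine Finset.sum_congr rfl fun u _ => ?_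
  simp only [and_comm]
/-- Pair marginal for slots `(0,1)` (same AND-pair). -/
theorem marg2_ip3Law_01 {r : ℝ} (hr : 2 * r ^ 2 = 1) (b α β : Bool) :
    marg2 (ip3Law r b) 0 1 α β = rho r α * rho r β := by
  cases b <;> cases α <;> cases β <;> simp [marg2, sum_fin6, ip3Law_cons, rho]
  · linear_combination (2*r^4 - 4*r^3 + r^2 + 2*r - 1) * hr
  · linear_combination ((-2)*r^4 + 2*r^3 + r^2 - r) * hr
  · linear_combination ((-2)*r^4 + 2*r^3 + r^2 - r) * hr
  · linear_combination ((-2)*r^4 + r^2) * hr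
  · linear_combination ((-2)*r^4 + 4*r^3 - r^2 - 2*r + 1) * hr
  · linear_combination (2*r^4 - 2*r^3 - r^2 + r) * hr
  · linear_combination (2*r^4 - 2*r^3 - r^2 + r) * hr
  · linear_combination (2*r^4 - r^2) * hr

/-- Pair marginal for slots `(0,2)` (different AND-pairs). -/
theorem marg2_ip3Law_02 {r : ℝ} (hr : 2 * r ^ 2 = 1) (b α β : Bool) :
    marg2 (ip3Law r b) 0 2 α β = rho r α * rho r β := by
  cases b <;> cases α <;> cases β <;> simp [marg2, sum_fin6, ip3Law_cons, rho]
  · linear_combination (-r^2 + 2*r - 1) * hr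
  · linear_combination ((-2)*r^3 + 3*r^2 - r) * hr
  · linear_combination ((-2)*r^3 + 3*r^2 - r) * hr
  · linear_combination ((-4)*r^4 + 4*r^3 - r^2) * hr
  · linear_combination (r^2 - 2*r + 1) * hr
  · linear_combination (2*r^3 - 3*r^2 + r) * hr
  · linear_combination (2*r^3 - 3*r^2 + r) * hr
  · linear_combination (4*r^4 - 4*r^3 + r^2) * hr

/-- Pair marginal for slots `(0,3)` (different AND-pairs). -/
theorem marg2_ip3Law_03 {r : ℝ} (hr : 2 * r ^ 2 = 1) (b α β : Bool) :
    marg2 (ip3Law r b) 0 3 α β = rho r α * rho r β := by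
  cases b <;> cases α <;> cases β <;> simp [marg2, sum_fin6, ip3Law_cons, rho]
  · linear_combination (-r^2 + 2*r - 1) * hr
  · linear_combination ((-2)*r^3 + 3*r^2 - r) * hr
  · linear_combination ((-2)*r^3 + 3*r^2 - r) * hr
  · linear_combination ((-4)*r^4 + 4*r^3 - r^2) * hr
  · linear_combination (r^2 - 2*r + 1) * hr
  · linear_combination (2*r^3 - 3*r^2 + r) * hr
  · linear_combination (2*r^3 - 3*r^2 + r) * hr
  · linear_combination (4*r^4 - 4*r^3 + r^2) * hr

/-- Pair marginal for slots `(0,4)` (different AND-pairs). -/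
theorem marg2_ip3Law_04 {r : ℝ} (hr : 2 * r ^ 2 = 1) (b α β : Bool) :
    marg2 (ip3Law r b) 0 4 α β = rho r α * rho r β := by
  cases b <;> cases α <;> cases β <;> simp [marg2, sum_fin6, ip3Law_cons, rho]
  · linear_combination (-r^2 + 2*r - 1) * hr
  · linear_combination ((-2)*r^3 + 3*r^2 - r) * hr
  · linear_combination ((-2)*r^3 + 3*r^2 - r) * hr
  · linear_combination ((-4)*r^4 + 4*r^3 - r^2) * hr
  · linear_combination (r^2 - 2*r + 1) * hr
  · linear_combination (2*r^3 - 3*r^2 + r) * hr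
  · linear_combination (2*r^3 - 3*r^2 + r) * hr
  · linear_combination (4*r^4 - 4*r^3 + r^2) * hr

/-- Pair marginal for slots `(0,5)` (different AND-pairs). -/
theorem marg2_ip3Law_05 {r : ℝ} (hr : 2 * r ^ 2 = 1) (b α β : Bool) :
    marg2 (ip3Law r b) 0 5 α β = rho r α * rho r β := by
  cases b <;> cases α <;> cases β <;> simp [marg2, sum_fin6, ip3Law_cons, rho]
  · linear_combination (-r^2 + 2*r - 1) * hr
  · linear_combination ((-2)*r^3 + 3*r^2 - r) * hr
  · linear_combination ((-2)*r^3 + 3*r^2 - r) * hr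
  · linear_combination ((-4)*r^4 + 4*r^3 - r^2) * hr
  · linear_combination (r^2 - 2*r + 1) * hr
  · linear_combination (2*r^3 - 3*r^2 + r) * hr
  · linear_combination (2*r^3 - 3*r^2 + r) * hr
  · linear_combination (4*r^4 - 4*r^3 + r^2) * hr

/-- Pair marginal for slots `(1,2)` (different AND-pairs). -/
theorem marg2_ip3Law_12 {r : ℝ} (hr : 2 * r ^ 2 = 1) (b α β : Bool) :
    marg2 (ip3Law r b) 1 2 α β = rho r α * rho r β := by
  cases b <;> cases α <;> cases β <;> simp [marg2, sum_fin6, ip3Law_cons, rho]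
  · linear_combination (-r^2 + 2*r - 1) * hr
  · linear_combination ((-2)*r^3 + 3*r^2 - r) * hr
  · linear_combination ((-2)*r^3 + 3*r^2 - r) * hr
  · linear_combination ((-4)*r^4 + 4*r^3 - r^2) * hr
  · linear_combination (r^2 - 2*r + 1) * hr
  · linear_combination (2*r^3 - 3*r^2 + r) * hr
  · linear_combination (2*r^3 - 3*r^2 + r) * hr
  · linear_combination (4*r^4 - 4*r^3 + r^2) * hr

/-- Pair marginal for slots `(1,3)` (different AND-pairs). -/
theorem marg2_ip3Law_13 {r : ℝ} (hr : 2 * r ^ 2 = 1) (b α β : Bool) :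
    marg2 (ip3Law r b) 1 3 α β = rho r α * rho r β := by
  cases b <;> cases α <;> cases β <;> simp [marg2, sum_fin6, ip3Law_cons, rho]
  · linear_combination (-r^2 + 2*r - 1) * hr
  · linear_combination ((-2)*r^3 + 3*r^2 - r) * hr
  · linear_combination ((-2)*r^3 + 3*r^2 - r) * hr
  · linear_combination ((-4)*r^4 + 4*r^3 - r^2) * hr
  · linear_combination (r^2 - 2*r + 1) * hr
  · linear_combination (2*r^3 - 3*r^2 + r) * hr
  · linear_combination (2*r^3 - 3*r^2 + r) * hr
  · linear_combination (4*r^4 - 4*r^3 + r^2) * hr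

/-- Pair marginal for slots `(1,4)` (different AND-pairs). -/
theorem marg2_ip3Law_14 {r : ℝ} (hr : 2 * r ^ 2 = 1) (b α β : Bool) :
    marg2 (ip3Law r b) 1 4 α β = rho r α * rho r β := by
  cases b <;> cases α <;> cases β <;> simp [marg2, sum_fin6, ip3Law_cons, rho]
  · linear_combination (-r^2 + 2*r - 1) * hr
  · linear_combination ((-2)*r^3 + 3*r^2 - r) * hr
  · linear_combination ((-2)*r^3 + 3*r^2 - r) * hr
  · linear_combination ((-4)*r^4 + 4*r^3 - r^2) * hr
  · linear_combination (r^2 - 2*r + 1) * hr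
  · linear_combination (2*r^3 - 3*r^2 + r) * hr
  · linear_combination (2*r^3 - 3*r^2 + r) * hr
  · linear_combination (4*r^4 - 4*r^3 + r^2) * hr

/-- Pair marginal for slots `(1,5)` (different AND-pairs). -/
theorem marg2_ip3Law_15 {r : ℝ} (hr : 2 * r ^ 2 = 1) (b α β : Bool) :
    marg2 (ip3Law r b) 1 5 α β = rho r α * rho r β := by
  cases b <;> cases α <;> cases β <;> simp [marg2, sum_fin6, ip3Law_cons, rho]
  · linear_combination (-r^2 + 2*r - 1) * hr
  · linear_combination ((-2)*r^3 + 3*r^2 - r) * hr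
  · linear_combination ((-2)*r^3 + 3*r^2 - r) * hr
  · linear_combination ((-4)*r^4 + 4*r^3 - r^2) * hr
  · linear_combination (r^2 - 2*r + 1) * hr
  · linear_combination (2*r^3 - 3*r^2 + r) * hr
  · linear_combination (2*r^3 - 3*r^2 + r) * hr
  · linear_combination (4*r^4 - 4*r^3 + r^2) * hr

/-- Pair marginal for slots `(2,3)` (same AND-pair). -/
theorem marg2_ip3Law_23 {r : ℝ} (hr : 2 * r ^ 2 = 1) (b α β : Bool) :
    marg2 (ip3Law r b) 2 3 α β = rho r α * rho r β := by
  cases b <;> cases α <;> cases β <;> simp [marg2, sum_fin6, ip3Law_cons, rho]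
  · linear_combination (2*r^4 - 4*r^3 + r^2 + 2*r - 1) * hr
  · linear_combination ((-2)*r^4 + 2*r^3 + r^2 - r) * hr
  · linear_combination ((-2)*r^4 + 2*r^3 + r^2 - r) * hr
  · linear_combination ((-2)*r^4 + r^2) * hr
  · linear_combination ((-2)*r^4 + 4*r^3 - r^2 - 2*r + 1) * hr
  · linear_combination (2*r^4 - 2*r^3 - r^2 + r) * hr
  · linear_combination (2*r^4 - 2*r^3 - r^2 + r) * hr
  · linear_combination (2*r^4 - r^2) * hr

/-- Pair marginal for slots `(2,4)` (different AND-pairs). -/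
theorem marg2_ip3Law_24 {r : ℝ} (hr : 2 * r ^ 2 = 1) (b α β : Bool) :
    marg2 (ip3Law r b) 2 4 α β = rho r α * rho r β := by
  cases b <;> cases α <;> cases β <;> simp [marg2, sum_fin6, ip3Law_cons, rho]
  · linear_combination (-r^2 + 2*r - 1) * hr
  · linear_combination ((-2)*r^3 + 3*r^2 - r) * hr
  · linear_combination ((-2)*r^3 + 3*r^2 - r) * hr
  · linear_combination ((-4)*r^4 + 4*r^3 - r^2) * hr
  · linear_combination (r^2 - 2*r + 1) * hr
  · linear_combination (2*r^3 - 3*r^2 + r) * hr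
  · linear_combination (2*r^3 - 3*r^2 + r) * hr
  · linear_combination (4*r^4 - 4*r^3 + r^2) * hr

/-- Pair marginal for slots `(2,5)` (different AND-pairs). -/
theorem marg2_ip3Law_25 {r : ℝ} (hr : 2 * r ^ 2 = 1) (b α β : Bool) :
    marg2 (ip3Law r b) 2 5 α β = rho r α * rho r β := by
  cases b <;> cases α <;> cases β <;> simp [marg2, sum_fin6, ip3Law_cons, rho]
  · linear_combination (-r^2 + 2*r - 1) * hr
  · linear_combination ((-2)*r^3 + 3*r^2 - r) * hr
  · linear_combination ((-2)*r^3 + 3*r^2 - r) * hr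
  · linear_combination ((-4)*r^4 + 4*r^3 - r^2) * hr
  · linear_combination (r^2 - 2*r + 1) * hr
  · linear_combination (2*r^3 - 3*r^2 + r) * hr
  · linear_combination (2*r^3 - 3*r^2 + r) * hr
  · linear_combination (4*r^4 - 4*r^3 + r^2) * hr

/-- Pair marginal for slots `(3,4)` (different AND-pairs). -/
theorem marg2_ip3Law_34 {r : ℝ} (hr : 2 * r ^ 2 = 1) (b α β : Bool) :
    marg2 (ip3Law r b) 3 4 α β = rho r α * rho r β := by
  cases b <;> cases α <;> cases β <;> simp [marg2, sum_fin6, ip3Law_cons, rho]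
  · linear_combination (-r^2 + 2*r - 1) * hr
  · linear_combination ((-2)*r^3 + 3*r^2 - r) * hr
  · linear_combination ((-2)*r^3 + 3*r^2 - r) * hr
  · linear_combination ((-4)*r^4 + 4*r^3 - r^2) * hr
  · linear_combination (r^2 - 2*r + 1) * hr
  · linear_combination (2*r^3 - 3*r^2 + r) * hr
  · linear_combination (2*r^3 - 3*r^2 + r) * hr
  · linear_combination (4*r^4 - 4*r^3 + r^2) * hr

/-- Pair marginal for slots `(3,5)` (different AND-pairs). -/
theorem marg2_ip3Law_35 {r : ℝ} (hr : 2 * r ^ 2 = 1) (b α β : Bool) :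
    marg2 (ip3Law r b) 3 5 α β = rho r α * rho r β := by
  cases b <;> cases α <;> cases β <;> simp [marg2, sum_fin6, ip3Law_cons, rho]
  · linear_combination (-r^2 + 2*r - 1) * hr
  · linear_combination ((-2)*r^3 + 3*r^2 - r) * hr
  · linear_combination ((-2)*r^3 + 3*r^2 - r) * hr
  · linear_combination ((-4)*r^4 + 4*r^3 - r^2) * hr
  · linear_combination (r^2 - 2*r + 1) * hr
  · linear_combination (2*r^3 - 3*r^2 + r) * hr
  · linear_combination (2*r^3 - 3*r^2 + r) * hr
  · linear_combination (4*r^4 - 4*r^3 + r^2) * hr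

/-- Pair marginal for slots `(4,5)` (same AND-pair). -/
theorem marg2_ip3Law_45 {r : ℝ} (hr : 2 * r ^ 2 = 1) (b α β : Bool) :
    marg2 (ip3Law r b) 4 5 α β = rho r α * rho r β := by
  cases b <;> cases α <;> cases β <;> simp [marg2, sum_fin6, ip3Law_cons, rho]
  · linear_combination (2*r^4 - 4*r^3 + r^2 + 2*r - 1) * hr
  · linear_combination ((-2)*r^4 + 2*r^3 + r^2 - r) * hr
  · linear_combination ((-2)*r^4 + 2*r^3 + r^2 - r) * hr
  · linear_combination ((-2)*r^4 + r^2) * hr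
  · linear_combination ((-2)*r^4 + 4*r^3 - r^2 - 2*r + 1) * hr
  · linear_combination (2*r^4 - 2*r^3 - r^2 + r) * hr
  · linear_combination (2*r^4 - 2*r^3 - r^2 + r) * hr
  · linear_combination (2*r^4 - r^2) * hr

/-- **Two-slot marginals**: `marg2 (ip3Law r b) s s' α β = ρ_r(α)·ρ_r(β)` for distinct slots (uses `2r² = 1`). -/
theorem marg2_ip3Law {r : ℝ} (hr : 2 * r ^ 2 = 1) (b : Bool) (s s' : Fin 6) (hss : s ≠ s') (α β : Bool) :
    marg2 (ip3Law r b) s s' α β = rho r α * rho r β := by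
  fin_cases s <;> fin_cases s'
  all_goals (first | exact absurd rfl hss | skip)
  · exact marg2_ip3Law_01 hr b α β
  · exact marg2_ip3Law_02 hr b α β
  · exact marg2_ip3Law_03 hr b α β
  · exact marg2_ip3Law_04 hr b α β
  · exact marg2_ip3Law_05 hr b α β
  · rw [marg2_comm, mul_comm]; exact marg2_ip3Law_01 hr b β α
  · exact marg2_ip3Law_12 hr b α β
  · exact marg2_ip3Law_13 hr b α β
  · exact marg2_ip3Law_14 hr b α β
  · exact marg2_ip3Law_15 hr b α β
  · rw [marg2_comm, mul_comm]; exact marg2_ip3Law_02 hr b β α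
  · rw [marg2_comm, mul_comm]; exact marg2_ip3Law_12 hr b β α
  · exact marg2_ip3Law_23 hr b α β
  · exact marg2_ip3Law_24 hr b α β
  · exact marg2_ip3Law_25 hr b α β
  · rw [marg2_comm, mul_comm]; exact marg2_ip3Law_03 hr b β α
  · rw [marg2_comm, mul_comm]; exact marg2_ip3Law_13 hr b β α
  · rw [marg2_comm, mul_comm]; exact marg2_ip3Law_23 hr b β α
  · exact marg2_ip3Law_34 hr b α β
  · exact marg2_ip3Law_35 hr b α β
  · rw [marg2_comm, mul_comm]; exact marg2_ip3Law_04 hr b β α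
  · rw [marg2_comm, mul_comm]; exact marg2_ip3Law_14 hr b β α
  · rw [marg2_comm, mul_comm]; exact marg2_ip3Law_24 hr b β α
  · rw [marg2_comm, mul_comm]; exact marg2_ip3Law_34 hr b β α
  · exact marg2_ip3Law_45 hr b α β
  · rw [marg2_comm, mul_comm]; exact marg2_ip3Law_05 hr b β α
  · rw [marg2_comm, mul_comm]; exact marg2_ip3Law_15 hr b β α
  · rw [marg2_comm, mul_comm]; exact marg2_ip3Law_25 hr b β α
  · rw [marg2_comm, mul_comm]; exact marg2_ip3Law_35 hr b β α
  · rw [marg2_comm, mul_comm]; exact marg2_ip3Law_45 hr b β α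

/-! ## The pairwise laws of a pure `IP₃` instance -/

/-- `r = √2/2` satisfies `2r² = 1`, `0 < r < 1`. -/
theorem rhalf_spec : 2 * (Real.sqrt 2 / 2) ^ 2 = 1 ∧ 0 < Real.sqrt 2 / 2 ∧ Real.sqrt 2 / 2 < 1 := by
  have h2 : Real.sqrt 2 ^ 2 = 2 := Real.sq_sqrt (by norm_num)
  have hpos : 0 < Real.sqrt 2 := Real.sqrt_pos.2 (by norm_num)
  refine ⟨by nlinarith, by positivity, ?_⟩
  nlinarith

/-- **T22.1a(i).**  Every pure `IP₃` instance carries pairwise-independent fibre laws with all biases `√2/2`, for EVERY target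
`y`: `PairwiseLaws I y (fun _ => √2/2) (fun j => ip3Law (√2/2) (y j))`. -/
theorem pairwiseLaws_ip3 (I : LocalMap 6 n m) (hI : I.IsPure (ipPred 3)) (y : Fin m → Bool) :
    PairwiseLaws I y (fun _ => Real.sqrt 2 / 2) (fun j => ip3Law (Real.sqrt 2 / 2) (y j)) := by
  obtain ⟨hr, h0, h1⟩ := rhalf_spec
  refine ⟨fun _ => h0, fun _ => h1, fun j u => ip3Law_nonneg h0.le h1.le _ u, fun j => ip3Law_total hr _,
    fun j u hu => ?_, fun j s α => marg1_ip3Law hr _ s α, fun j s s' hss α β => ?_⟩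
  · rw [hI.1 j]; exact ip3Law_support _ _ u hu
  · rw [marg2_ip3Law hr _ s s' hss, marg1_ip3Law hr, marg1_ip3Law hr]

/-- **`IP3PairwiseLaws` by name-shape**: every pure `IP₃` instance has pairwise-independent fibre laws for every target (the
hypothesis of the ROUND-22 hub `PairwiseSALevel.PairwiseSALinearLevel` at `k = 6`). -/
theorem ip3PairwiseLaws : ∀ (n m : ℕ) (I : LocalMap 6 n m), I.IsPure (ipPred 3) → ∀ y : Fin m → Bool,
    ∃ (p : Fin n → ℝ) (μ : Fin m → (Fin 6 → Bool) → ℝ), PairwiseLaws I y p μ :=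
  fun _ _ I hI y => ⟨_, _, pairwiseLaws_ip3 I hI y⟩

end Summit.PneNP.PneNP.Theorems.PstarIP3Law
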